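import Summits.BirchSwinnertonDyer.BirchSwinnertonDyer.Theorems.EisensteinPrimesBSDpOnCellCAcDescentControlCoker
import Summits.BirchSwinnertonDyer.BirchSwinnertonDyer.Theorems.EisensteinPrimesBSDpOnCellCAcDescentFixedPointsFinite
import Summits.BirchSwinnertonDyer.BirchSwinnertonDyer.Theorems.SignedBaseChangeAnticyclotomicEisensteinDivisibilityFiniteExponentOfLOC1
import Summits.BirchSwinnertonDyer.BirchSwinnertonDyer.Theorems.SignedBaseChangeAnticyclotomicEisensteinDivisibilityTwistDeformationLOC1
import Literature.NumberTheory.IwasawaTheory.Greenberg2016.LocalCohomologyAlmostDivisible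
import Literature.NumberTheory.IwasawaTheory.Greenberg2006.LocalH2VanishingOfLOC1
import Literature.NumberTheory.GaloisRepresentations.LocalEulerPoincareCharacteristicProofs
import HarnessLib

/-!
# Crux 4 `BSDpOnCellC` (stmt-BirchSwinnertonDyer-19034), line «crystal» v10: **the registered `stub_acDescent` DERIVED from four PUBLISHED Greenberg
# facts that are ALREADY conjuncts of `stub_publishedFacts`** — `acDescent_of_greenbergFacts : prop411 → prop41 → prop32 → <stub VERBATIM>`
# (cell `bsd-eis`, width seat `bsd-line-x2-p2` gen 14; `--supports stmt-BirchSwinnertonDyer-19034`; skeleton of record UNCHANGED, W-79)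

WHY / WHAT. This seat's chain reduced `stub_acDescent` to ONE input (FE) «`X_Gr(E_K/K̃_∞)(𝔭̄)[T₁]` has finite exponent», and the pointwise proof
(`…AcDescentOfInputs.kolyvaginDivIntOther_of_twoVarRatDivPNew_of_control`) consumes (FE) ONLY on the branch `length_{(T₁)}(X_Gr₂) = 0` (on the other
branch the specialised ideal vanishes and `p^{c+e}·Q = 0`). OFF THE SUPPORT, the finite exponent of `X_Gr₂[T₁]` is EXACTLY the statement the cell
`bsd-ssimc` derived for its crux `AnticyclotomicEisensteinDivisibility` (stmt-…-20727, line `bdpline`, stub `stub_finiteExponentSS`) by the Greenberg-2016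
road: `SignedBaseChangeAcDivFiniteExponentTelescopeLOC1.finiteExponent_of_loc1` (bsd-line-sbc-p1-w3, on the LEAD's telescope p628494 and the width
seat's `…NoPseudoNull` assembly) for ANY elliptic `W` over an imaginary quadratic `K`, `p > 2`, `v ≠ v̄` above `p`, a generator pair — NO reduction
hypothesis — GRANTED six named facts, of which Greenberg 2016 Prop. 4.2.2, Greenberg 2006 §5 A and Prop. 4.2 are tree theorems (`…_holds`;
Prop. 4.2 = `Greenberg2006.LocalEulerPoincareCorank.prop42_localEulerPoincareCorank_holds`, from Tate's local Euler characteristic) and the Galois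
brick (R1b) is `SignedBaseChangeAcDivTwistLOC1.stub_twistDeformationLOC1SS` (proved for every curve). The remaining THREE — Greenberg 2016 Prop. 4.1.1
`prop411_selmer_isAlmostDivisible`, Greenberg 2006 Props. 4.1 `prop41_globalEulerPoincareCorank`, 3.2 `prop32_cohomology_isCofinitelyGenerated` — are
CONJUNCTS of crystal v10's `stub_publishedFacts` (the Greenberg block of the «TEN of p668130''»; `prop42_localEulerPoincareCorank` is there too, now idle).

* §1 `finiteExponentOffSupport_of_greenbergFacts` — the bdpline theorem instantiated (discrete topologies as in bsd-ssimc's `…OfFiniteExponentTateTC`).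
* §2 `kolyvaginDivIntOther_of_twoVarRatDivPNew_of_greenbergFacts` — X2's R-β conclusion at one datum from `TwoVarRatDivPNew W p` and the three facts
  (the pointwise proof of `…AcDescentOfInputs` with (FE) supplied by §1 on the branch where it is used, and (Ctrl) by
  `control_of_fixedExponent` ∘ `WeierstrassCurve.exists_pow_smul_eq_zero_of_fixed_pairKer`, p702662/p703372).
* §3 **`acDescent_of_greenbergFacts : prop411_… → prop41_… → prop32_… → <stub_acDescent VERBATIM>`**.

CONSEQUENCE FOR THE LINE (for a successor LEAD; this seat registers nothing, W-79): in crystal v10's composition the `hDescent` slot can be fed by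
`acDescent_of_greenbergFacts h411 h41 h32` (projections of `hPub`) — `stub_acDescent` is REDUNDANT given `stub_publishedFacts` (6 → 5 stubs; residual of crux 4 on
crystal = 27 PUB(-chain) + crux 3 + `stub_twoVarRatDivPNew` (UNPRINTED) + the KY-grade named statements of `stub_memberInvariants`/`stub_wallAlgebraic`).

HONEST FRAMING: CONDITIONAL on three PUBLISHED named facts (Greenberg 2016 Prop. 4.1.1; Greenberg 2006 Props. 3.2, 4.1) already carried by the
skeleton; no new named fact, no definition, no sorry; nothing about BSD / MC / IMC is proved for any curve; 0 cells / labels / tiers move.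

References: [Greenberg2016Selmer] Prop. 4.1.1 (p. 15), Prop. 4.2.2; [Greenberg2006] Props. 3.2, 4.1, 4.2, §5 A; [Greenberg2010] Lemma 5.2.2; [Ochiai2006]
Lemma 7.2; [SkinnerUrban2014] §3.2.7–3.2.8; [GreenbergLNM1716] §3 Lemma 3.1; tree: bsd-ssimc `SignedBaseChangeAnticyclotomicEisensteinDivisibility{FiniteExponentOfLOC1,
FiniteExponentTelescope,NoPseudoNullOfBricks,TwistDeformationLOC1}`, this seat's p699999–p703801, `Lines/crystal.lean` v10.
-/

set_option autoImplicit false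
set_option linter.dupNamespace false

noncomputable section

open scoped Classical

/-! ## §1 The finite exponent of `X_Gr₂[T₁]` off the support, from the Greenberg facts (bsd-ssimc's bdpline road, instantiated) -/

namespace Summit.BirchSwinnertonDyer.BirchSwinnertonDyer.Theorems.AcDescent

open NumberField IsDedekindDomain Field Literature.NumberTheory.EllipticCurves Literature.NumberTheory.GaloisRepresentations
  Literature.NumberTheory.IwasawaTheory Literature.NumberTheory.IwasawaTheory.Greenberg2006 Literature.NumberTheory.IwasawaTheory.Greenberg2016

/-- **Finite exponent of `X_Gr(E/K̃_∞)(v̄)[T₁]` off the support from the Greenberg facts** — for ANY elliptic curve `W` over an imaginary quadratic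
`K`, `p > 2`, `v ≠ v̄` above `p`, `κ₁` cyclotomic, `κ₂` anticyclotomic with a generator pair: if `length_{(T₁)}(X_Gr₂) = 0` then
`∃ m, p^m · X_Gr₂[T₁] = 0`, GRANTED Greenberg 2016 Prop. 4.1.1 and Greenberg 2006 Props. 4.1, 3.2 BY NAME — bsd-ssimc's
`SignedBaseChangeAcDivFiniteExponentTelescopeLOC1.finiteExponent_of_loc1` with Greenberg 2016 Prop. 4.2.2 / Greenberg 2006 §5 A / Prop. 4.2 supplied
by their tree proofs, (R1b) by `SignedBaseChangeAcDivTwistLOC1.stub_twistDeformationLOC1SS`, and the discrete topologies on `Λ₁, Λ₂`.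
[cite: Greenberg2016Selmer, Prop. 4.1.1 (p. 15)] [cite: Greenberg2006, Props. 3.2, 4.1, 4.2, §5 A] [cite: Greenberg2010, Lemma 5.2.2] -/
theorem finiteExponentOffSupport_of_greenbergFacts
    (h411 : prop411_selmer_isAlmostDivisible) (h41 : prop41_globalEulerPoincareCorank)
    (h32 : prop32_cohomology_isCofinitelyGenerated)
    {K : Type} [Field K] [NumberField K] (hK : IsImaginaryQuadratic K) (W : WeierstrassCurve K) [W.IsElliptic]
    {p : ℕ} [Fact p.Prime] (hp : 2 < p) {κ₁ κ₂ : ZpExtension K p} (hκ₁ : κ₁.IsCyclotomic) (hκ₂ : κ₂.IsAnticyclotomic)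
    {v vbar : HeightOneSpectrum (𝓞 K)} (hv : ((p : ℕ) : 𝓞 K) ∈ v.asIdeal) (hvbar : ((p : ℕ) : 𝓞 K) ∈ vbar.asIdeal) (hne : vbar ≠ v)
    (γ₁ γ₂ : absoluteGaloisGroup K) [Fact (ZpExtension.IsTopGeneratorPair κ₁ κ₂ γ₁ γ₂)]
    (h0 : Literature.NumberTheory.EllipticCurves.Module.lengthAt (IwasawaAlgebra₂ p) (W.XGr₂ p κ₁ κ₂ vbar γ₁ γ₂)
      ⟨Ideal.span {(PowerSeries.X : IwasawaAlgebra₂ p)}, PowerSeries.span_X_isPrime⟩ = 0) :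
    ∃ m : ℕ, ∀ x : W.XGr₂ p κ₁ κ₂ vbar γ₁ γ₂,
      (PowerSeries.X : IwasawaAlgebra₂ p) • x = 0 → ((p : IwasawaAlgebra₂ p) ^ m) • x = 0 := by
  -- the discrete topological instances of bsd-ssimc's model
  letI tΛ₁ : TopologicalSpace (PowerSeries ℤ_[p]) := ⊥
  letI tΛ₂ : TopologicalSpace (PowerSeries (PowerSeries ℤ_[p])) := ⊥
  haveI : DiscreteTopology (PowerSeries (PowerSeries ℤ_[p])) := ⟨rfl⟩
  haveI : IsTopologicalRing (PowerSeries (PowerSeries ℤ_[p])) := inferInstance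
  haveI : IsTopologicalAddGroup (IndModule₂ ℤ_[p] p (PrimaryTorsion W.geomPoints p)) := inferInstance
  haveI : ContinuousSMul (PowerSeries (PowerSeries ℤ_[p])) (IndModule₂ ℤ_[p] p (PrimaryTorsion W.geomPoints p)) := inferInstance
  exact Summit.BirchSwinnertonDyer.BirchSwinnertonDyer.Theorems.SignedBaseChangeAcDivFiniteExponentTelescopeLOC1.finiteExponent_of_loc1
    W κ₁ κ₂ vbar γ₁ γ₂ h411 prop422_localCohomology_isAlmostDivisible_holds sec5A_localH2_subsingleton_of_LOC1_holds h41
    Literature.NumberTheory.IwasawaTheory.Greenberg2006.LocalEulerPoincareCorank.prop42_localEulerPoincareCorank_holds h32 hp hK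
    hv hvbar hne
    (fun ρ₀ hρ₀ ↦ Summit.BirchSwinnertonDyer.BirchSwinnertonDyer.Theorems.SignedBaseChangeAcDivTwistLOC1.stub_twistDeformationLOC1SS
      K W p κ₁ κ₂ γ₁ γ₂ hK hp hκ₁ hκ₂ ρ₀ hρ₀) h0

end Summit.BirchSwinnertonDyer.BirchSwinnertonDyer.Theorems.AcDescent

/-! ## §2 X2's R-β conclusion at one datum from `TwoVarRatDivPNew W p` and the three Greenberg facts -/

namespace Summit.BirchSwinnertonDyer.BirchSwinnertonDyer.Theorems.AcDescent

open scoped MatrixGroups ModularForm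

open CongruenceSubgroup WeierstrassCurve NumberField IsDedekindDomain Field PowerSeries
  Literature.NumberTheory.EllipticCurves Literature.NumberTheory.EllipticCurves.GreenbergSelmer
  Literature.NumberTheory.EllipticCurves.ModularForms Literature.NumberTheory.QuadraticFields
  Literature.NumberTheory.EllipticCurves.Rank1Residual
  Literature.NumberTheory.EllipticCurves.Rank1Residual.Typed
  Literature.NumberTheory.GaloisRepresentations Literature.NumberTheory.GaloisCohomology
  Literature.NumberTheory.Automorphic
  Summit.BirchSwinnertonDyer.Rank1Residual.X11b.AcSelmer
  Summit.BirchSwinnertonDyer.Rank1Residual.X11b.Halves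
  Summit.BirchSwinnertonDyer.Rank1Residual.X11b
  Summit.BirchSwinnertonDyer.Rank1Residual Summit.BirchSwinnertonDyer.Rank1Residual.X1
  Summit.BirchSwinnertonDyer.Rank1Residual.X2
open Literature.NumberTheory.IwasawaTheory.Greenberg2006 Literature.NumberTheory.IwasawaTheory.Greenberg2016
open Summit.BirchSwinnertonDyer.BirchSwinnertonDyer.Theorems.EisensteinPrimesBSDpOnCellCAccumDefs (TwoVarRatDivPNew)
open Summit.BirchSwinnertonDyer.BirchSwinnertonDyer.Theorems.SignedBaseChangeAcDivSpecialization
  Summit.BirchSwinnertonDyer.BirchSwinnertonDyer.Theorems.SignedBaseChangeAcDivSpecialization.LocalLength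
open Literature.NumberTheory.EllipticCurves.Module (lengthAt)
open Summit.BirchSwinnertonDyer.BirchSwinnertonDyer.Theorems.SignedBaseChangeAcDivSpecialization.PowerSeriesSpecialization
  (mem_span_X_iff)

/-- **X2's R-β conclusion at ONE datum from `TwoVarRatDivPNew W p` and the three Greenberg facts.** The pointwise proof of
`…AcDescentOfInputs.kolyvaginDivIntOther_of_twoVarRatDivPNew_of_control` (partner pair at the lift `γδ`; `TwoVarRatDivPNew` there; dichotomy on
`(T₁) ∈ Supp X_Gr₂`; off the support the coker algebra with `X_ac^∅` f.g.; `p^c·L₂(0)·u = p^{c+e}·Q`; back to `γ`), with (FE) supplied ON THAT BRANCH by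
`finiteExponentOffSupport_of_greenbergFacts` and (Ctrl) by `control_of_fixedExponent` ∘ `WeierstrassCurve.exists_pow_smul_eq_zero_of_fixed_pairKer`.
[cite: Greenberg2016Selmer, Prop. 4.1.1] [cite: Greenberg2006, Props. 3.2, 4.1, 4.2] [cite: Ochiai2006, Lemma 7.2 (Compositio Math. 142 pp. 1187–1188)] -/
theorem kolyvaginDivIntOther_of_twoVarRatDivPNew_of_greenbergFacts
    (h411 : prop411_selmer_isAlmostDivisible) (h41 : prop41_globalEulerPoincareCorank)
    (h32 : prop32_cohomology_isCofinitelyGenerated)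
    (W : WeierstrassCurve ℚ) [W.IsElliptic] [W.IsGloballyMinimal] (p : ℕ) [Fact p.Prime]
    (hTwo : TwoVarRatDivPNew W p)
    (N : ℕ) [NeZero N] (K : Type) [Field K] [NumberField K] (Dt : ModularParametrizationData W N)
    (H : HeegnerDatum N (NumberField.discr K)) (ιK : K →+* ℂ) (P : (W.baseChange K).toAffine.Point)
    (hC : CellC W p) (hN : W.conductorNorm ℤ = N)
    (hK : IsImaginaryQuadratic K) (hD : NumberField.discr K < -4) (hHeeg : SatisfiesHeegnerHypothesis N K)
    (hL1 : (W.quadraticTwist (NumberField.discr K : ℚ)).entireLFunction 1 ≠ 0)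
    (hP : WeierstrassCurve.Affine.Point.map ιK.toRatAlgHom P = heegnerPointComplex Dt H)
    (hc : ¬ (p : ℤ) ∣ Dt.c) (hPt : ¬ IsOfFinAddOrder P) (hodd : Odd (NumberField.discr K))
    (κ : ZpExtension K p) (hκ : κ.IsAnticyclotomic)
    (γ : Field.absoluteGaloisGroup K) [Fact (κ.IsTopGenerator γ)]
    (𝔭 : HeightOneSpectrum (𝓞 K)) (h𝔭 : ((p : ℕ) : 𝓞 K) ∈ 𝔭.asIdeal)
    (he : 𝔭.asIdeal.ramificationIdx (𝓞 ℚ) = 1) (hdeg : 𝔭.asIdeal.inertiaDeg (𝓞 ℚ) = 1)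
    (𝔭bar : HeightOneSpectrum (𝓞 K)) (h𝔭bar : ((p : ℕ) : 𝓞 K) ∈ 𝔭bar.asIdeal) (hne : 𝔭bar ≠ 𝔭)
    (hsplit : ((Ideal.span {(p : ℤ)}).primesOver (𝓞 K)).ncard = 2)
    (f : CuspForm (CongruenceSubgroup.Gamma0 N) 2) (hf : IsNewformOf W f)
    (ι' : PadicAlgCl p ≃+* ℂ)
    (hι' : ∀ (w : InfinitePlace K) (k : 𝓞 K), k ∈ 𝔭.asIdeal ↔ ‖ι'.symm (w.embedding (k : K))‖ < 1)
    (ΩK : ℂ) (Ωp : ℂ_[p]) (Q : PowerSeries 𝓞_ℂ_[p]) (hΩK : ΩK ≠ 0) (hΩp : ‖Ωp‖ = 1)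
    (hQ : R1.IsBDPLFunctionInt p ι' 𝔭 κ γ f ΩK Ωp Q) :
    ∃ k : ℕ, PowerSeries.C ((p : 𝓞_ℂ_[p]) ^ k) * Q ∈
      (XAc.charIdeal (W.baseChange K) p κ 𝔭bar ∅ γ).map (PowerSeries.map (R1.toCpInt p)) := by
  -- the cyclotomic partner pair at the lift `γ' = γδ`
  have hp2 : p ≠ 2 := hC.2.1
  obtain ⟨κ₁, hκ₁, δ, hδ, γ₁, hpair⟩ :=
    ZpExtension.exists_cyclotomic_isTopGeneratorPair_mul hK hp2 hκ (Fact.out : κ.IsTopGenerator γ)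
  haveI hFpair : Fact (ZpExtension.IsTopGeneratorPair κ₁ κ γ₁ (γ * δ)) := ⟨hpair⟩
  haveI hFγ' : Fact (κ.IsTopGenerator (γ * δ)) := ⟨hpair.2.2.2⟩
  have hQ' : R1.IsBDPLFunctionInt p ι' 𝔭 κ (γ * δ) f ΩK Ωp Q :=
    (R1.isBDPLFunctionInt_mul_iff_of_mem hδ).mpr hQ
  -- the two-variable divisibility at the lift
  obtain ⟨hfin, htors, L₂, c, e, u, hu, hmem, hL0⟩ := hTwo N K Dt H ιK P hC hN hK hD hHeeg hL1 hP hc hPt hodd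
    κ hκ (γ * δ) 𝔭 h𝔭 he hdeg 𝔭bar h𝔭bar hne hsplit f hf ι' hι' ΩK Ωp Q hΩK hΩp hQ' κ₁ hκ₁ γ₁
  haveI := hfin
  -- read the target at the lift (`X_ac` does not see `δ`; the X11b copy is Castella's, definitionally)
  rw [show XAc.charIdeal (W.baseChange K) p κ 𝔭bar ∅ γ =
      Castella2018.AcSelmer.XAc.charIdeal (W.baseChange K) p κ 𝔭bar ∅ (γ * δ) from
    (Castella2018.AcSelmer.XAc.charIdeal_mul_eq_of_mem (W.baseChange K) p κ 𝔭bar ∅ hδ).symm]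
  -- the specialised element `p^c · L₂(0)` and the bookkeeping `p^k · (p^c · L₂(0)) · u = p^(k+c+e) · Q`
  have hy : PowerSeries.C ((p : 𝓞_ℂ_[p]) ^ c) * PowerSeries.constantCoeff L₂ ∈
      ((Module.charIdeal (IwasawaAlgebra₂ p) ((W.baseChange K).XGr₂ p κ₁ κ 𝔭bar γ₁ (γ * δ))).map
        (IwasawaAlgebra₂.toUnr₂ p (R1.toCpInt p))).map
        (PowerSeries.constantCoeff (R := PowerSeries 𝓞_ℂ_[p])) := by
    have h := Ideal.mem_map_of_mem (PowerSeries.constantCoeff (R := PowerSeries 𝓞_ℂ_[p])) hmem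
    rwa [map_mul, PowerSeries.constantCoeff_C] at h
  have key : ∀ (k : ℕ) (I : Ideal (PowerSeries 𝓞_ℂ_[p])),
      PowerSeries.C ((p : 𝓞_ℂ_[p]) ^ k) * (PowerSeries.C ((p : 𝓞_ℂ_[p]) ^ c) * PowerSeries.constantCoeff L₂) ∈ I →
      PowerSeries.C ((p : 𝓞_ℂ_[p]) ^ (k + c + e)) * Q ∈ I := by
    intro k I h
    have h' := I.mul_mem_right u h
    have e1 : PowerSeries.C ((p : 𝓞_ℂ_[p]) ^ k) * (PowerSeries.C ((p : 𝓞_ℂ_[p]) ^ c) * PowerSeries.constantCoeff L₂) * u =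
        PowerSeries.C ((p : 𝓞_ℂ_[p]) ^ (k + c + e)) * Q := by
      rw [mul_assoc, mul_assoc, hL0, pow_add, pow_add, map_mul, map_mul]
      ring
    rwa [e1] at h'
  by_cases h0 : lengthAt (IwasawaAlgebra₂ p) ((W.baseChange K).XGr₂ p κ₁ κ 𝔭bar γ₁ (γ * δ))
      ⟨Ideal.span {(PowerSeries.X : IwasawaAlgebra₂ p)}, PowerSeries.span_X_isPrime⟩ = 0
  · -- `(T₁) ∉ Supp X_Gr₂`: a killing `s` with `s(0) ≠ 0`; then §1
    obtain ⟨s, hsX, hs⟩ := exists_notMem_forall_smul_eq_zero_of_lengthAt_eq_zero h0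
    have hp2' : 2 < p := lt_of_le_of_ne (Fact.out : p.Prime).two_le (Ne.symm hp2)
    obtain ⟨m, hm⟩ := finiteExponentOffSupport_of_greenbergFacts h411 h41 h32 hK (W.baseChange K) hp2' hκ₁ hκ
      h𝔭 h𝔭bar hne γ₁ (γ * δ) h0
    obtain ⟨a₀, ha₀⟩ := W.exists_pow_smul_eq_zero_of_fixed_pairKer hp2 hK hD hκ₁ hκ hpair
    obtain ⟨φ, a, ha⟩ := control_of_fixedExponent (W.baseChange K) p κ₁ κ 𝔭bar γ₁ (γ * δ) ha₀
    haveI : Module.Finite (IwasawaAlgebra p) (Castella2018.AcSelmer.XAc (W.baseChange K) p κ 𝔭bar ∅ (γ * δ)) :=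
      Castella2018.AcSelmer.XAc.module_finite_empty (W.baseChange K) p κ 𝔭bar (γ * δ)
    obtain ⟨k, hk⟩ := S2Coker.map_toUnr₂_map_constantCoeff_le_rat_of_coker p
      ((W.baseChange K).XGr₂ p κ₁ κ 𝔭bar γ₁ (γ * δ)) (Castella2018.AcSelmer.XAc (W.baseChange K) p κ 𝔭bar ∅ (γ * δ))
      ⟨s, fun h => hsX ((mem_span_X_iff (A := IwasawaAlgebra p)).mpr h), hs⟩ ⟨m, hm⟩ φ ⟨a, ha⟩ (R1.toCpInt p)
    exact ⟨k + c + e, key k _ (hk _ hy)⟩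
  · -- `(T₁) ∈ Supp X_Gr₂`: the specialised ideal vanishes, so `p^(c+e) · Q = p^c · L₂(0) · u = 0`
    have hbot := S2.map_toUnr₂_map_constantCoeff_eq_bot_of_lengthAt_ne_zero p
      ((W.baseChange K).XGr₂ p κ₁ κ 𝔭bar γ₁ (γ * δ)) htors h0 (R1.toCpInt p)
    rw [hbot, Ideal.mem_bot] at hy
    refine ⟨0 + c + e, key 0 _ ?_⟩
    rw [hy, mul_zero]
    exact Ideal.zero_mem _

/-! ## §3 The registered `stub_acDescent` from the three Greenberg facts -/

/-- **`stub_acDescent` (crystal v10, VERBATIM) ⟸ Greenberg 2016 Prop. 4.1.1 ∧ Greenberg 2006 Props. 4.1, 3.2** — three PUBLISHED named facts that are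
already conjuncts of crystal v10's `stub_publishedFacts`. So the registered stub is REDUNDANT given `stub_publishedFacts`: a successor LEAD may feed the
composition's `hDescent` slot with `acDescent_of_greenbergFacts h411 h41 h32` projected from `hPub`. CONDITIONAL on the three facts; nothing asserted.
[cite: Greenberg2016Selmer, Prop. 4.1.1 (p. 15)] [cite: Greenberg2006, Props. 3.2, 4.1, 4.2] [cite: Ochiai2006, Def. 7.1 and Lemma 7.2 (Compositio Math. 142 pp. 1187–1188)]
[cite: BurungaleCastellaSkinner2025, §2.1 and Thm. 4.1.3 (arXiv:2405.00270v2 pp. 6, 8)] -/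
theorem acDescent_of_greenbergFacts
    (h411 : prop411_selmer_isAlmostDivisible) (h41 : prop41_globalEulerPoincareCorank)
    (h32 : prop32_cohomology_isCofinitelyGenerated) :
    (∀ (W : WeierstrassCurve ℚ) [W.IsElliptic] [W.IsGloballyMinimal] (p : ℕ) [Fact p.Prime],
      CellC W p → TwoVarRatDivPNew W p) →
    (∀ (W : WeierstrassCurve ℚ) [W.IsElliptic] [W.IsGloballyMinimal] (p : ℕ) [Fact p.Prime],
      CellC W p → ¬ W.HasSplitMultiplicativeReductionAtPrime p → NonsplitKolyvaginDivOnTreeIntOther W p) ∧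
    (∀ (W : WeierstrassCurve ℚ) [W.IsElliptic] [W.IsGloballyMinimal] (p : ℕ) [Fact p.Prime],
      CellC W p → W.HasSplitMultiplicativeReductionAtPrime p → SplitKolyvaginDivOnTreeIntOther W p) := by
  intro hTwo
  refine ⟨fun W _ _ p _ hC _ => ?_, fun W _ _ p _ hC _ => ?_⟩
  · intro N _ K _ _ Dt H ιK P hC' _ hN hK hD hHeeg hL1 hP hc hPt hodd κ hκ γ _ 𝔭 h𝔭 he hdeg 𝔭bar h𝔭bar hne hsplit
      f hf ι' hι' ΩK Ωp Q hΩK hΩp hQ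
    exact kolyvaginDivIntOther_of_twoVarRatDivPNew_of_greenbergFacts h411 h41 h32 W p (hTwo W p hC) N K Dt H ιK P hC' hN hK hD
      hHeeg hL1 hP hc hPt hodd κ hκ γ 𝔭 h𝔭 he hdeg 𝔭bar h𝔭bar hne hsplit f hf ι' hι' ΩK Ωp Q hΩK hΩp hQ
  · intro N _ K _ _ Dt H ιK P hC' _ hN hK hD hHeeg hL1 hP hc hPt hodd κ hκ γ _ 𝔭 h𝔭 he hdeg 𝔭bar h𝔭bar hne hsplit
      f hf ι' hι' ΩK Ωp Q hΩK hΩp hQ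
    exact kolyvaginDivIntOther_of_twoVarRatDivPNew_of_greenbergFacts h411 h41 h32 W p (hTwo W p hC) N K Dt H ιK P hC' hN hK hD
      hHeeg hL1 hP hc hPt hodd κ hκ γ 𝔭 h𝔭 he hdeg 𝔭bar h𝔭bar hne hsplit f hf ι' hι' ΩK Ωp Q hΩK hΩp hQ

end Summit.BirchSwinnertonDyer.BirchSwinnertonDyer.Theorems.AcDescent

end
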